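import Literature.Computability.Complexity.ThetaFWMachineTables
import Literature.Combinatorics.SimpleGraph.LovaszThetaFWCap
import HarnessLib

/-!
# The Frank–Wolfe machine for `ϑ`, II: the entry functions, the power loop, one saturated step, the main loop

Topic `Computability/Complexity`; continues `ThetaFWMachineTables.lean` (table codes, `mzipF`, `mulCapF`,
`frobF`) towards the discharge of `Literature.Computability.Complexity.GLS1981_thetaApprox_unary_FP`.
Here the string functions realising the saturated recursion of
`Combinatorics/SimpleGraph/LovaszThetaFWCap.lean` (`ThetaFW.gradCap`, `powCap`, `stepCap`, `iterCap`)
literally, on records carrying the yardstick `x` (`W = |x|`):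

* the codes the machine runs on: `maskCode H` (the table of pairs `⟨[ij ∈ E], [i = j]⟩` as canonical
  integer codes), the scalar record `scCode n m = ⟨bin T, ⟨bin r, ⟨2M, ⟨c₀, ⟨2ᵖ, n⟩⟩⟩⟩⟩` and the parameter
  record `prmCode = ⟨bin n, ⟨maskCode H, ⟨matCode 1, scCode⟩⟩⟩`;
* the entry functions `gradItem` (`capZ W (τ - e·2M·Nᵢⱼ + δ·τc₀)`, an entry of `gradCap`), `stepItem`
  (`capZ W (2ᵖ(t Nᵢⱼ Tr P + 2τ Pᵢⱼ) / ((t+2) τ Tr P) + δ n)`, an entry of `stepCap`), `pairItem`, `enItem`;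
* `powF` — `r` rounds of `P ↦ mulCapF ⟨A, P⟩` from `P = 1` (`powCap W N r`), a counted loop;
* `stepF ⟨x, ⟨dpEnc t, ⟨prmCode, matCode N⟩⟩⟩ = matCode (stepCap W t N)` (`stepF_apply`);
* `mainBody`, `coreF ⟨x, ⟨bin T, ⟨prmCode, matCode 1⟩⟩⟩ = matCode (iterCap W T)` (`coreF_apply`), the
  clocked main loop (the step index `t = T - counter`).

Every function comes with membership in `FP` and, where a loop needs it, an all-input length bound
(the tables are *absolutely* bounded by a polynomial of `|x|`, by saturation).

## References

* M. Jaggi, arXiv:1108.1170 (2011), Alg. 6, Thm. 17–18 [Jaggi2011].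
* M. Grötschel, L. Lovász, A. Schrijver, Combinatorica 1 (1981), §6 [GrotschelLovaszSchrijver1981].
* S. Arora, B. Barak, *Computational Complexity: A Modern Approach*, CUP 2009, §1.3 [AroraBarak2009].
-/

noncomputable section

namespace Literature.Computability.Complexity

namespace ThetaFWMachine

open _root_.Computability Polynomial Brick Literature.Algebra.EuclideanLattices
  Literature.Algebra.EuclideanLattices.LLLMachine Literature.Combinatorics.SimpleGraph
  Literature.Combinatorics.SimpleGraph.ThetaFW Matrix

variable {n : ℕ}

/-! ### Codes: indicators, the mask table, scalars, parameters -/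

/-- The edge indicator `[ij ∈ E]` as an integer. [folklore] -/
def eInd (H : SimpleGraph (Fin n)) [DecidableRel H.Adj] (i j : Fin n) : ℤ := if H.Adj i j then 1 else 0

/-- The diagonal indicator `[i = j]` as an integer. [folklore] -/
def dInd (i j : Fin n) : ℤ := if i = j then 1 else 0

/-- **The mask table**: entry `(i, j)` is the pair `⟨dpEnc [ij ∈ E], dpEnc [i = j]⟩`. [folklore] -/
def maskCode (H : SimpleGraph (Fin n)) [DecidableRel H.Adj] : List Bool :=
  tabCode fun i j => boolPair (dpEnc (eInd H i j)) (dpEnc (dInd i j))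

/-- **The scalar record** `⟨bin T, ⟨bin r, ⟨dpEnc 2M, ⟨dpEnc c₀, ⟨dpEnc 2ᵖ, dpEnc n⟩⟩⟩⟩⟩` of the constants of
`ThetaFW`. [folklore] -/
def scCode (n m : ℕ) : List Bool :=
  boolPair (encodeNat (cT n m)) (boolPair (encodeNat (cr n m)) (boolPair (dpEnc (2 * cM n m))
    (boolPair (dpEnc (c0 n m)) (boolPair (dpEnc (2 ^ cp n m)) (dpEnc n)))))

/-- **The parameter record** `⟨bin n, ⟨maskCode H, ⟨matCode 1, scCode n m⟩⟩⟩` kept through the main loop.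
[folklore] -/
def prmCode (m : ℕ) (H : SimpleGraph (Fin n)) [DecidableRel H.Adj] : List Bool :=
  boolPair (encodeNat n) (boolPair (maskCode H) (boolPair (matCode (1 : Matrix (Fin n) (Fin n) ℤ)) (scCode n m)))

/-- The recoder `u ↦ ⟨u, ε⟩` of a numeral as a canonical integer code. [folklore] -/
def natToZF : List Bool → List Bool := fanoutFn (fun w => w) (fun _ => [])

/-- `natToZF (bin k) = dpEnc k` (the canonical code of a natural number is `⟨bin k, ε⟩`, cf.
`Cryptography.dpEnc_natCast`, not imported here). [folklore] -/
@[simp] theorem natToZF_encodeNat (k : ℕ) : natToZF (encodeNat k) = dpEnc (k : ℤ) := by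
  rw [dpEnc, Int.toNat_natCast, show (-(k : ℤ)).toNat = 0 by omega]
  simp [natToZF, TokConv.encodeNat_zero']

/-- `natToZF ∈ FP`. [folklore] -/
theorem natToZF_mem_FP : natToZF ∈ FP := fanoutFn_mem_FP OracleCompose.id_mem_FP (const_mem_FP _)

/-- `|natToZF u| = 2|u| + 2`. [folklore] -/
@[simp] theorem length_natToZF (u : List Bool) : (natToZF u).length = 2 * u.length + 2 := by
  simp [natToZF]

/-! ### The entry function of the shifted gradient -/

/-- The value part of `gradItem` on `r = ⟨x, ⟨⟨zτ, ⟨z2M, zc₀⟩⟩, ⟨⟨e, δ⟩, nᵢⱼ⟩⟩⟩`: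
`(τ - e (2M nᵢⱼ)) + δ (τ c₀)`. [folklore] -/
def gradVal : List Bool → List Bool :=
  zaddF ∘ fanoutFn
    (zsubF ∘ fanoutFn (fstF ∘ nthF 1) (zmulF ∘ fanoutFn (fstF ∘ nthF 2) (zmulF ∘ fanoutFn (fstF ∘ sndF ∘ nthF 1) (sndPow 2))))
    (zmulF ∘ fanoutFn (sndF ∘ nthF 2) (zmulF ∘ fanoutFn (fstF ∘ nthF 1) (sndF ∘ sndF ∘ nthF 1)))

/-- `gradVal ∈ FP`. [folklore] -/
theorem gradVal_mem_FP : gradVal ∈ FP :=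
  comp_mem_FP zaddF_mem_FP (fanoutFn_mem_FP
    (comp_mem_FP zsubF_mem_FP (fanoutFn_mem_FP (comp_mem_FP fstF_mem_FP (nthF_mem_FP 1))
      (comp_mem_FP zmulF_mem_FP (fanoutFn_mem_FP (comp_mem_FP fstF_mem_FP (nthF_mem_FP 2))
        (comp_mem_FP zmulF_mem_FP (fanoutFn_mem_FP (comp_mem_FP fstF_mem_FP (comp_mem_FP sndF_mem_FP (nthF_mem_FP 1))) (sndPow_mem_FP 2)))))))
    (comp_mem_FP zmulF_mem_FP (fanoutFn_mem_FP (comp_mem_FP sndF_mem_FP (nthF_mem_FP 2))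
      (comp_mem_FP zmulF_mem_FP (fanoutFn_mem_FP (comp_mem_FP fstF_mem_FP (nthF_mem_FP 1))
        (comp_mem_FP sndF_mem_FP (comp_mem_FP sndF_mem_FP (nthF_mem_FP 1))))))))

/-- Value of `gradVal` on canonical codes. [folklore] -/
theorem gradVal_apply (x : List Bool) (τ M2 c e δ v : ℤ) :
    gradVal (boolPair x (boolPair (boolPair (dpEnc τ) (boolPair (dpEnc M2) (dpEnc c))) (boolPair (boolPair (dpEnc e) (dpEnc δ)) (dpEnc v)))) =
      dpEnc (τ - e * (M2 * v) + δ * (τ * c)) := by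
  simp [gradVal]

/-- **The entry function of the saturated shifted gradient** on `⟨x, ⟨⟨zτ, ⟨z2M, zc₀⟩⟩, ⟨⟨e, δ⟩, nᵢⱼ⟩⟩⟩`:
`zcapF ⟨x, τ - e·2M·nᵢⱼ + δ·τ·c₀⟩` (an entry of `ThetaFW.gradCap`). [cite: Jaggi2011, §4, Alg. 6 (the gradient of the penalised objective)] -/
def gradItem : List Bool → List Bool := zcapF ∘ fanoutFn (nthF 0) gradVal

/-- `gradItem ∈ FP`. [folklore] -/
theorem gradItem_mem_FP : gradItem ∈ FP := comp_mem_FP zcapF_mem_FP (fanoutFn_mem_FP (nthF_mem_FP 0) gradVal_mem_FP)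

/-- `gradItem` saturates: `≤ 2|x| + 2` on every input. [folklore] -/
theorem length_gradItem_le (x p a b : List Bool) :
    (gradItem (boolPair x (boolPair p (boolPair a b)))).length ≤ 0 * (a.length + b.length) + (2 * X + 2 : Polynomial ℕ).eval x.length := by
  have := length_zcapF_le (boolPair x (gradVal (boolPair x (boolPair p (boolPair a b)))))
  simp only [gradItem, Function.comp_apply, fanoutFn_apply, nthF_zero_boolPair, fstF_boolPair, eval_add, eval_mul, eval_ofNat,
    eval_X, zero_mul, zero_add] at this ⊢
  exact this

/-- **Semantics of `gradItem`.** [folklore] -/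
theorem gradItem_apply (x : List Bool) (τ M2 c e δ v : ℤ) :
    gradItem (boolPair x (boolPair (boolPair (dpEnc τ) (boolPair (dpEnc M2) (dpEnc c))) (boolPair (boolPair (dpEnc e) (dpEnc δ)) (dpEnc v)))) =
      dpEnc (ThetaFW.capZ x.length (τ - e * (M2 * v) + δ * (τ * c))) := by
  simp only [gradItem, Function.comp_apply, fanoutFn_apply, nthF_zero_boolPair]
  rw [gradVal_apply, zcapF_dpEnc, ThetaFW.capZ]

/-! ### The pairing and the edge-product entry functions -/

/-- The pairing entry function on `⟨x, ⟨p, ⟨a, b⟩⟩⟩`: `⟨a, b⟩`. [folklore] -/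
def pairItem : List Bool → List Bool := sndPow 1

/-- `pairItem ∈ FP`. [folklore] -/
theorem pairItem_mem_FP : pairItem ∈ FP := sndPow_mem_FP 1

/-- `pairItem` on a record. [folklore] -/
@[simp] theorem pairItem_apply (x p a b : List Bool) : pairItem (boolPair x (boolPair p (boolPair a b))) = boolPair a b := by
  simp [pairItem]

/-- Size of `pairItem`: `≤ 2(|a| + |b|) + 2`. [folklore] -/
theorem length_pairItem_le (x p a b : List Bool) :
    (pairItem (boolPair x (boolPair p (boolPair a b)))).length ≤ 2 * (a.length + b.length) + (2 : Polynomial ℕ).eval x.length := by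
  rw [pairItem_apply, length_boolPair, eval_ofNat]; omega

/-- The edge-product entry function on `⟨x, ⟨p, ⟨⟨e, δ⟩, nᵢⱼ⟩⟩⟩`: `e · nᵢⱼ` (canonical). [folklore] -/
def enItem : List Bool → List Bool := zmulF ∘ fanoutFn (fstF ∘ nthF 2) (sndPow 2)

/-- `enItem ∈ FP`. [folklore] -/
theorem enItem_mem_FP : enItem ∈ FP :=
  comp_mem_FP zmulF_mem_FP (fanoutFn_mem_FP (comp_mem_FP fstF_mem_FP (nthF_mem_FP 2)) (sndPow_mem_FP 2))

/-- **Semantics of `enItem`.** [folklore] -/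
theorem enItem_apply (x p : List Bool) (e δ v : ℤ) :
    enItem (boolPair x (boolPair p (boolPair (boolPair (dpEnc e) (dpEnc δ)) (dpEnc v)))) = dpEnc (e * v) := by
  simp [enItem]

/-- Size of `enItem`: `≤ 2(|a| + |b|) + 2`. [folklore] -/
theorem length_enItem_le (x p a b : List Bool) :
    (enItem (boolPair x (boolPair p (boolPair a b)))).length ≤ 2 * (a.length + b.length) + (2 : Polynomial ℕ).eval x.length := by
  have h1 := length_zmulF_le (fstF a) b
  have h2 := zlen_le_length (fstF a)
  have h3 := zlen_le_length b
  have h4 := length_fstF_sndF_le a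
  simp only [enItem, Function.comp_apply, fanoutFn_apply, nthF_succ_boolPair, nthF_zero_boolPair, sndPow_succ_boolPair,
    sndPow_zero, sndF_boolPair, eval_ofNat]
  omega

/-! ### The entry function of the Frank–Wolfe step -/

/-- The numerator `2ᵖ ((t nᵢⱼ) trP + (2 τ) pᵢⱼ)` on
`r = ⟨x, ⟨⟨z2ᵖ, ⟨zt, ⟨zτ, ⟨ztrP, zn⟩⟩⟩⟩, ⟨⟨e, δ⟩, ⟨nᵢⱼ, pᵢⱼ⟩⟩⟩⟩`. [folklore] -/
def stepNumF : List Bool → List Bool :=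
  zmulF ∘ fanoutFn (fstF ∘ nthF 1)
    (zaddF ∘ fanoutFn
      (zmulF ∘ fanoutFn (zmulF ∘ fanoutFn (fstF ∘ sndF ∘ nthF 1) (fstF ∘ sndPow 2)) (fstF ∘ sndF ∘ sndF ∘ sndF ∘ nthF 1))
      (zmulF ∘ fanoutFn (zmulF ∘ fanoutFn (fun _ => dpEnc 2) (fstF ∘ sndF ∘ sndF ∘ nthF 1)) (sndF ∘ sndPow 2)))

/-- The denominator `((t + 2) τ) trP`. [folklore] -/
def stepDenF : List Bool → List Bool :=
  zmulF ∘ fanoutFn (zmulF ∘ fanoutFn (zaddF ∘ fanoutFn (fstF ∘ sndF ∘ nthF 1) (fun _ => dpEnc 2)) (fstF ∘ sndF ∘ sndF ∘ nthF 1))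
    (fstF ∘ sndF ∘ sndF ∘ sndF ∘ nthF 1)

/-- The value part of `stepItem`: `num / den + δ · n`. [folklore] -/
def stepVal : List Bool → List Bool :=
  zaddF ∘ fanoutFn (zedivF ∘ fanoutFn stepNumF stepDenF)
    (zmulF ∘ fanoutFn (sndF ∘ nthF 2) (sndF ∘ sndF ∘ sndF ∘ sndF ∘ nthF 1))

/-- `stepNumF ∈ FP`. [folklore] -/
theorem stepNumF_mem_FP : stepNumF ∈ FP :=
  comp_mem_FP zmulF_mem_FP (fanoutFn_mem_FP (comp_mem_FP fstF_mem_FP (nthF_mem_FP 1))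
    (comp_mem_FP zaddF_mem_FP (fanoutFn_mem_FP
      (comp_mem_FP zmulF_mem_FP (fanoutFn_mem_FP
        (comp_mem_FP zmulF_mem_FP (fanoutFn_mem_FP (comp_mem_FP fstF_mem_FP (comp_mem_FP sndF_mem_FP (nthF_mem_FP 1))) (comp_mem_FP fstF_mem_FP (sndPow_mem_FP 2))))
        (comp_mem_FP fstF_mem_FP (comp_mem_FP sndF_mem_FP (comp_mem_FP sndF_mem_FP (comp_mem_FP sndF_mem_FP (nthF_mem_FP 1)))))))
      (comp_mem_FP zmulF_mem_FP (fanoutFn_mem_FP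
        (comp_mem_FP zmulF_mem_FP (fanoutFn_mem_FP (const_mem_FP _) (comp_mem_FP fstF_mem_FP (comp_mem_FP sndF_mem_FP (comp_mem_FP sndF_mem_FP (nthF_mem_FP 1))))))
        (comp_mem_FP sndF_mem_FP (sndPow_mem_FP 2)))))))

/-- `stepDenF ∈ FP`. [folklore] -/
theorem stepDenF_mem_FP : stepDenF ∈ FP :=
  comp_mem_FP zmulF_mem_FP (fanoutFn_mem_FP
    (comp_mem_FP zmulF_mem_FP (fanoutFn_mem_FP
      (comp_mem_FP zaddF_mem_FP (fanoutFn_mem_FP (comp_mem_FP fstF_mem_FP (comp_mem_FP sndF_mem_FP (nthF_mem_FP 1))) (const_mem_FP _)))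
      (comp_mem_FP fstF_mem_FP (comp_mem_FP sndF_mem_FP (comp_mem_FP sndF_mem_FP (nthF_mem_FP 1))))))
    (comp_mem_FP fstF_mem_FP (comp_mem_FP sndF_mem_FP (comp_mem_FP sndF_mem_FP (comp_mem_FP sndF_mem_FP (nthF_mem_FP 1))))))

/-- `stepVal ∈ FP`. [folklore] -/
theorem stepVal_mem_FP : stepVal ∈ FP :=
  comp_mem_FP zaddF_mem_FP (fanoutFn_mem_FP (comp_mem_FP zedivF_mem_FP (fanoutFn_mem_FP stepNumF_mem_FP stepDenF_mem_FP))
    (comp_mem_FP zmulF_mem_FP (fanoutFn_mem_FP (comp_mem_FP sndF_mem_FP (nthF_mem_FP 2))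
      (comp_mem_FP sndF_mem_FP (comp_mem_FP sndF_mem_FP (comp_mem_FP sndF_mem_FP (comp_mem_FP sndF_mem_FP (nthF_mem_FP 1))))))))

/-- The step record of scalars `⟨dpEnc 2ᵖ, ⟨dpEnc t, ⟨dpEnc τ, ⟨dpEnc trP, dpEnc n⟩⟩⟩⟩`. [folklore] -/
def stepPrm (p2 t τ trP nn : ℤ) : List Bool :=
  boolPair (dpEnc p2) (boolPair (dpEnc t) (boolPair (dpEnc τ) (boolPair (dpEnc trP) (dpEnc nn))))

/-- Value of `stepVal` on canonical codes. [folklore] -/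
theorem stepVal_apply (x : List Bool) (p2 t τ trP nn e δ v w : ℤ) :
    stepVal (boolPair x (boolPair (stepPrm p2 t τ trP nn) (boolPair (boolPair (dpEnc e) (dpEnc δ)) (boolPair (dpEnc v) (dpEnc w))))) =
      dpEnc (p2 * (t * v * trP + 2 * τ * w) / ((t + 2) * τ * trP) + δ * nn) := by
  simp only [stepVal, stepNumF, stepDenF, stepPrm, Function.comp_apply, fanoutFn_apply, nthF_zero_boolPair, nthF_succ_boolPair,
    sndPow_succ_boolPair, sndPow_zero, sndF_boolPair, fstF_boolPair, zmulF_boolPair, zaddF_boolPair, ival_dpEnc]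
  rw [zedivF_dpEnc, ival_dpEnc]

/-- **The entry function of the saturated Frank–Wolfe step** on
`⟨x, ⟨⟨z2ᵖ, ⟨zt, ⟨zτ, ⟨ztrP, zn⟩⟩⟩⟩, ⟨⟨e, δ⟩, ⟨nᵢⱼ, pᵢⱼ⟩⟩⟩⟩`: `zcapF ⟨x, 2ᵖ(t nᵢⱼ trP + 2τ pᵢⱼ)/((t+2) τ trP) + δ n⟩`
(an entry of `ThetaFW.stepCap`). [cite: Jaggi2011, Alg. 6 (chunk p0020)] -/
def stepItem : List Bool → List Bool := zcapF ∘ fanoutFn (nthF 0) stepVal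

/-- `stepItem ∈ FP`. [folklore] -/
theorem stepItem_mem_FP : stepItem ∈ FP := comp_mem_FP zcapF_mem_FP (fanoutFn_mem_FP (nthF_mem_FP 0) stepVal_mem_FP)

/-- `stepItem` saturates: `≤ 2|x| + 2` on every input. [folklore] -/
theorem length_stepItem_le (x p a b : List Bool) :
    (stepItem (boolPair x (boolPair p (boolPair a b)))).length ≤ 0 * (a.length + b.length) + (2 * X + 2 : Polynomial ℕ).eval x.length := by
  have := length_zcapF_le (boolPair x (stepVal (boolPair x (boolPair p (boolPair a b)))))
  simp only [stepItem, Function.comp_apply, fanoutFn_apply, nthF_zero_boolPair, fstF_boolPair, eval_add, eval_mul, eval_ofNat,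
    eval_X, zero_mul, zero_add] at this ⊢
  exact this

/-- **Semantics of `stepItem`.** [folklore] -/
theorem stepItem_apply (x : List Bool) (p2 t τ trP nn e δ v w : ℤ) :
    stepItem (boolPair x (boolPair (stepPrm p2 t τ trP nn) (boolPair (boolPair (dpEnc e) (dpEnc δ)) (boolPair (dpEnc v) (dpEnc w))))) =
      dpEnc (ThetaFW.capZ x.length (p2 * (t * v * trP + 2 * τ * w) / ((t + 2) * τ * trP) + δ * nn)) := by
  simp only [stepItem, Function.comp_apply, fanoutFn_apply, nthF_zero_boolPair]
  rw [stepVal_apply, zcapF_dpEnc, ThetaFW.capZ]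


/-! ### The step record and its accessors -/

/-- The record one step runs on: `⟨x, ⟨dpEnc t, ⟨prmCode, matCode N⟩⟩⟩`. [folklore] -/
def stepRec (x : List Bool) (t : ℕ) (m : ℕ) (H : SimpleGraph (Fin n)) [DecidableRel H.Adj] (N : Matrix (Fin n) (Fin n) ℤ) : List Bool :=
  boolPair x (boolPair (dpEnc (t : ℤ)) (boolPair (prmCode m H) (matCode N)))

/-- Accessor: the yardstick `x` (field `0`). [folklore] -/
def Rx : List Bool → List Bool := nthF 0
/-- Accessor: the step index `dpEnc t` (field `1`). [folklore] -/
def Rt : List Bool → List Bool := nthF 1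
/-- Accessor: the current matrix (the tail after field `2`). [folklore] -/
def RN : List Bool → List Bool := sndPow 2
/-- Accessor: `bin n`. [folklore] -/
def Rnn : List Bool → List Bool := fstF ∘ nthF 2
/-- Accessor: the mask table. [folklore] -/
def RK : List Bool → List Bool := nthF 1 ∘ nthF 2
/-- Accessor: `matCode 1`. [folklore] -/
def RI : List Bool → List Bool := nthF 2 ∘ nthF 2
/-- Accessor: the scalar record. [folklore] -/
def Rsc : List Bool → List Bool := sndPow 2 ∘ nthF 2
/-- Accessor: `bin r`. [folklore] -/
def Rrr : List Bool → List Bool := nthF 1 ∘ Rsc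
/-- Accessor: `dpEnc 2M`. [folklore] -/
def R2M : List Bool → List Bool := nthF 2 ∘ Rsc
/-- Accessor: `dpEnc c₀`. [folklore] -/
def Rc0 : List Bool → List Bool := nthF 3 ∘ Rsc
/-- Accessor: `dpEnc 2ᵖ`. [folklore] -/
def R2p : List Bool → List Bool := nthF 4 ∘ Rsc
/-- Accessor: `dpEnc n`. [folklore] -/
def Rzn : List Bool → List Bool := sndPow 4 ∘ Rsc

/-- The accessors are in `FP`. [folklore] -/
theorem Rx_mem_FP : Rx ∈ FP := nthF_mem_FP 0
/-- `Rt ∈ FP`. [folklore] -/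
theorem Rt_mem_FP : Rt ∈ FP := nthF_mem_FP 1
/-- `RN ∈ FP`. [folklore] -/
theorem RN_mem_FP : RN ∈ FP := sndPow_mem_FP 2
/-- `Rnn ∈ FP`. [folklore] -/
theorem Rnn_mem_FP : Rnn ∈ FP := comp_mem_FP fstF_mem_FP (nthF_mem_FP 2)
/-- `RK ∈ FP`. [folklore] -/
theorem RK_mem_FP : RK ∈ FP := comp_mem_FP (nthF_mem_FP 1) (nthF_mem_FP 2)
/-- `RI ∈ FP`. [folklore] -/
theorem RI_mem_FP : RI ∈ FP := comp_mem_FP (nthF_mem_FP 2) (nthF_mem_FP 2)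
/-- `Rsc ∈ FP`. [folklore] -/
theorem Rsc_mem_FP : Rsc ∈ FP := comp_mem_FP (sndPow_mem_FP 2) (nthF_mem_FP 2)
/-- `Rrr ∈ FP`. [folklore] -/
theorem Rrr_mem_FP : Rrr ∈ FP := comp_mem_FP (nthF_mem_FP 1) Rsc_mem_FP
/-- `R2M ∈ FP`. [folklore] -/
theorem R2M_mem_FP : R2M ∈ FP := comp_mem_FP (nthF_mem_FP 2) Rsc_mem_FP
/-- `Rc0 ∈ FP`. [folklore] -/
theorem Rc0_mem_FP : Rc0 ∈ FP := comp_mem_FP (nthF_mem_FP 3) Rsc_mem_FP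
/-- `R2p ∈ FP`. [folklore] -/
theorem R2p_mem_FP : R2p ∈ FP := comp_mem_FP (nthF_mem_FP 4) Rsc_mem_FP
/-- `Rzn ∈ FP`. [folklore] -/
theorem Rzn_mem_FP : Rzn ∈ FP := comp_mem_FP (sndPow_mem_FP 4) Rsc_mem_FP

section Accessors

variable (x : List Bool) (t m : ℕ) (H : SimpleGraph (Fin n)) [DecidableRel H.Adj] (N : Matrix (Fin n) (Fin n) ℤ)

/-- `Rx` of a step record. [folklore] -/
@[simp] theorem Rx_stepRec : Rx (stepRec x t m H N) = x := by simp [Rx, stepRec]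
/-- `Rt` of a step record. [folklore] -/
@[simp] theorem Rt_stepRec : Rt (stepRec x t m H N) = dpEnc (t : ℤ) := by simp [Rt, stepRec]
/-- `RN` of a step record. [folklore] -/
@[simp] theorem RN_stepRec : RN (stepRec x t m H N) = matCode N := by simp [RN, stepRec]
/-- `Rnn` of a step record. [folklore] -/
@[simp] theorem Rnn_stepRec : Rnn (stepRec x t m H N) = encodeNat n := by simp [Rnn, stepRec, prmCode]
/-- `RK` of a step record. [folklore] -/
@[simp] theorem RK_stepRec : RK (stepRec x t m H N) = maskCode H := by simp [RK, stepRec, prmCode]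
/-- `RI` of a step record. [folklore] -/
@[simp] theorem RI_stepRec : RI (stepRec x t m H N) = matCode (1 : Matrix (Fin n) (Fin n) ℤ) := by simp [RI, stepRec, prmCode]
/-- `Rrr` of a step record. [folklore] -/
@[simp] theorem Rrr_stepRec : Rrr (stepRec x t m H N) = encodeNat (cr n m) := by simp [Rrr, Rsc, stepRec, prmCode, scCode]
/-- `R2M` of a step record. [folklore] -/
@[simp] theorem R2M_stepRec : R2M (stepRec x t m H N) = dpEnc (2 * cM n m) := by simp [R2M, Rsc, stepRec, prmCode, scCode]
/-- `Rc0` of a step record. [folklore] -/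
@[simp] theorem Rc0_stepRec : Rc0 (stepRec x t m H N) = dpEnc (c0 n m) := by simp [Rc0, Rsc, stepRec, prmCode, scCode]
/-- `R2p` of a step record. [folklore] -/
@[simp] theorem R2p_stepRec : R2p (stepRec x t m H N) = dpEnc (2 ^ cp n m) := by simp [R2p, Rsc, stepRec, prmCode, scCode]
/-- `Rzn` of a step record. [folklore] -/
@[simp] theorem Rzn_stepRec : Rzn (stepRec x t m H N) = dpEnc n := by simp [Rzn, Rsc, stepRec, prmCode, scCode]

end Accessors

/-- All accessors but `RN`, `Rt` read inside field `2` or field `0`; in particular `Rx = nthF 0`. [folklore] -/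
theorem Rx_eq : Rx = nthF 0 := rfl

/-! ### Mathematical identities linking the codes to `ThetaFW` -/

section Identities

variable (m : ℕ) (H : SimpleGraph (Fin n)) [DecidableRel H.Adj]

/-- `⟨1, N⟩ = Tr N`. [folklore] -/
theorem sum_one_mul_eq_trace (N : Matrix (Fin n) (Fin n) ℤ) : ∑ i, ∑ t, (1 : Matrix (Fin n) (Fin n) ℤ) i t * N i t = N.trace := by
  simp [Matrix.trace, Matrix.one_apply, ite_mul]

/-- The shifted gradient through the indicators. [folklore] -/
theorem gradInt_apply_eq (N : Matrix (Fin n) (Fin n) ℤ) (i j : Fin n) :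
    gradInt n m H N i j = N.trace - eInd H i j * (2 * (cM n m : ℤ) * N i j) + dInd i j * (N.trace * (c0 n m : ℤ)) := by
  unfold gradInt eInd dInd
  split_ifs <;> ring

/-- The saturated row-by-row product, entrywise. [folklore] -/
theorem capM_mulRR_eq (W : ℕ) (A P : Matrix (Fin n) (Fin n) ℤ) :
    capM n W (mulRR n A P) = fun i k => ThetaFW.capZ W (∑ t, A i t * P k t) := rfl

/-- **`mulCapF` computes `capM W (A ⊛ P)`** (the bridge from `ThetaFWMachineTables.mulCapF_apply` to the model
`ThetaFW.capM`/`ThetaFW.mulRR`). [folklore] -/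
theorem mulCapF_apply' (x : List Bool) (hn : n ≤ x.length) (A P : Matrix (Fin n) (Fin n) ℤ) :
    mulCapF (boolPair x (boolPair (encodeNat n) (boolPair (matCode A) (matCode P)))) = matCode (capM n x.length (mulRR n A P)) := by
  rw [mulCapF_apply x hn, capM_mulRR_eq]; rfl

/-- The saturated power loop is an iterate. [folklore] -/
theorem powCap_eq_iterate (W : ℕ) (N : Matrix (Fin n) (Fin n) ℤ) :
    ∀ j, powCap n m H W N j = (fun P => capM n W (mulRR n (gradCap n m H W N) P))^[j] 1
  | 0 => rfl
  | j + 1 => by rw [powCap, powCap_eq_iterate W N j, ← Function.iterate_succ_apply' (f := fun P => capM n W (mulRR n (gradCap n m H W N) P))]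

/-- The identity matrix code through the diagonal indicator. [folklore] -/
theorem matCode_one : matCode (1 : Matrix (Fin n) (Fin n) ℤ) = tabCode fun i j : Fin n => dpEnc (dInd i j) := by
  rw [matCode_eq_tabCode]; rfl

/-- The diagonal term of the step. [folklore] -/
theorem ite_eq_dInd_mul (i j : Fin n) (c : ℤ) : (if i = j then c else 0) = dInd i j * c := by
  unfold dInd; split_ifs <;> simp

end Identities

/-! ### The trace and the saturated shifted gradient -/

/-- **The trace** `τ = ⟨1, N⟩` of the current matrix: `frobF ⟨x, ⟨nn, ⟨I, N⟩⟩⟩`. [folklore] -/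
def tauF : List Bool → List Bool := frobF ∘ fanoutFn Rx (fanoutFn Rnn (fanoutFn RI RN))

/-- `tauF ∈ FP`. [folklore] -/
theorem tauF_mem_FP : tauF ∈ FP :=
  comp_mem_FP frobF_mem_FP (fanoutFn_mem_FP Rx_mem_FP (fanoutFn_mem_FP Rnn_mem_FP (fanoutFn_mem_FP RI_mem_FP RN_mem_FP)))

/-- **Semantics of `tauF`** (`n ≤ |x|`). [folklore] -/
theorem tauF_apply (x : List Bool) (hn : n ≤ x.length) (t m : ℕ) (H : SimpleGraph (Fin n)) [DecidableRel H.Adj]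
    (N : Matrix (Fin n) (Fin n) ℤ) : tauF (stepRec x t m H N) = dpEnc N.trace := by
  simp only [tauF, Function.comp_apply, fanoutFn_apply, Rx_stepRec, Rnn_stepRec, RI_stepRec, RN_stepRec]
  rw [frobF_apply x hn, sum_one_mul_eq_trace]

/-- The parameter record of the gradient entries: `⟨zτ, ⟨z2M, zc₀⟩⟩`. [folklore] -/
def gradPrmF : List Bool → List Bool := fanoutFn tauF (fanoutFn R2M Rc0)

/-- `gradPrmF ∈ FP`. [folklore] -/
theorem gradPrmF_mem_FP : gradPrmF ∈ FP := fanoutFn_mem_FP tauF_mem_FP (fanoutFn_mem_FP R2M_mem_FP Rc0_mem_FP)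

/-- **The saturated shifted gradient** `A = gradCap W N`: the zip of `gradItem` over the mask table and
`N`. [cite: Jaggi2011, §4, Alg. 6] -/
def gradF : List Bool → List Bool := mzipF gradItem ∘ fanoutFn Rx (fanoutFn Rnn (fanoutFn gradPrmF (fanoutFn RK RN)))

/-- `gradF ∈ FP`. [folklore] -/
theorem gradF_mem_FP : gradF ∈ FP :=
  comp_mem_FP (mzipF_mem_FP gradItem_mem_FP (w := 0) (by norm_num) length_gradItem_le)
    (fanoutFn_mem_FP Rx_mem_FP (fanoutFn_mem_FP Rnn_mem_FP (fanoutFn_mem_FP gradPrmF_mem_FP (fanoutFn_mem_FP RK_mem_FP RN_mem_FP))))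

/-- **Semantics of `gradF`** (`n ≤ |x|`): `matCode (gradCap |x| N)`. [cite: Jaggi2011, §4, Alg. 6] -/
theorem gradF_apply (x : List Bool) (hn : n ≤ x.length) (t m : ℕ) (H : SimpleGraph (Fin n)) [DecidableRel H.Adj]
    (N : Matrix (Fin n) (Fin n) ℤ) : gradF (stepRec x t m H N) = matCode (gradCap n m H x.length N) := by
  have hτ := tauF_apply x hn t m H N
  simp only [gradF, gradPrmF, Function.comp_apply, fanoutFn_apply, Rx_stepRec, Rnn_stepRec, RK_stepRec, RN_stepRec, R2M_stepRec,
    Rc0_stepRec, hτ, maskCode, matCode_eq_tabCode]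
  rw [mzipF_apply _ x hn]
  refine congrArg tabCode (funext fun i => funext fun j => ?_)
  rw [gradItem_apply, gradCap, capM, gradInt_apply_eq]

/-! ### The power loop -/

/-- The body of the power loop on `⟨x, ⟨cnt, ⟨⟨nn, A⟩, P⟩⟩⟩`: `⟨⟨nn, A⟩, mulCapF ⟨x, ⟨nn, ⟨A, P⟩⟩⟩⟩`.
[cite: Jaggi2011, §4, Thm. 18 (power iteration)] -/
def powBody : List Bool → List Bool :=
  fanoutFn (nthF 2) (mulCapF ∘ fanoutFn (nthF 0) (fanoutFn (fstF ∘ nthF 2) (fanoutFn (sndF ∘ nthF 2) (sndPow 2))))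

/-- `powBody ∈ FP`. [folklore] -/
theorem powBody_mem_FP : powBody ∈ FP :=
  fanoutFn_mem_FP (nthF_mem_FP 2) (comp_mem_FP mulCapF_mem_FP (fanoutFn_mem_FP (nthF_mem_FP 0)
    (fanoutFn_mem_FP (comp_mem_FP fstF_mem_FP (nthF_mem_FP 2)) (fanoutFn_mem_FP (comp_mem_FP sndF_mem_FP (nthF_mem_FP 2)) (sndPow_mem_FP 2)))))

/-- The growth polynomial of the power body. [folklore] -/
def powGrowth : Polynomial ℕ := X * (2 * (X * (4 * X + 8)) + 4) + 2

/-- Growth of the power body: `≤ |state| + powGrowth(|x|)` on every input. [folklore] -/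
theorem length_powBody_le (z : List Bool) : (powBody z).length ≤ (sndPow 1 z).length + powGrowth.eval (fstF z).length := by
  have c1 := length_nthF_succ_add_sndPow_succ_le 1 z
  have h := length_mulCapF_le (boolPair (nthF 0 z) (boolPair (fstF (nthF 2 z)) (boolPair (sndF (nthF 2 z)) (sndPow 2 z))))
  simp only [fstF_boolPair, Nat.reduceAdd] at h c1
  simp only [powBody, fanoutFn_apply, length_boolPair, Function.comp_apply, powGrowth, eval_add, eval_mul, eval_ofNat, eval_X, nthF_zero]
  have : nthF 0 z = fstF z := rfl
  rw [this] at h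
  omega

/-- **One round of the power loop.** [folklore] -/
theorem powBody_apply (x c : List Bool) (hn : n ≤ x.length) (A P : Matrix (Fin n) (Fin n) ℤ) :
    powBody (boolPair x (boolPair c (boolPair (boolPair (encodeNat n) (matCode A)) (matCode P)))) =
      boolPair (boolPair (encodeNat n) (matCode A)) (matCode (capM n x.length (mulRR n A P))) := by
  simp only [powBody, fanoutFn_apply, nthF_succ_boolPair, nthF_zero_boolPair, Function.comp_apply, sndPow_succ_boolPair, sndPow_zero,
    sndF_boolPair, fstF_boolPair]
  rw [mulCapF_apply' x hn]

/-- **The power loop computes iterates.** [folklore] -/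
theorem loopModel_powBody (x : List Bool) (hn : n ≤ x.length) (A : Matrix (Fin n) (Fin n) ℤ) :
    ∀ (j : ℕ) (P : Matrix (Fin n) (Fin n) ℤ),
      loopModel powBody x j (boolPair (boolPair (encodeNat n) (matCode A)) (matCode P)) =
        boolPair (boolPair (encodeNat n) (matCode A)) (matCode ((fun Q => capM n x.length (mulRR n A Q))^[j] P))
  | 0, P => rfl
  | j + 1, P => by
    rw [loopModel, powBody_apply x _ hn, loopModel_powBody x hn A j, ← Function.iterate_succ_apply]

/-- The power loop with its projection: on `⟨x, ⟨bin r, ⟨⟨nn, A⟩, P₀⟩⟩⟩`, the matrix after `r` rounds. [folklore] -/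
def powLoopF : List Bool → List Bool := sndPow 2 ∘ loopX powBody

/-- `powLoopF ∈ FP`. [folklore] -/
theorem powLoopF_mem_FP : powLoopF ∈ FP := comp_mem_FP (sndPow_mem_FP 2) (loopX_mem_FP powBody_mem_FP length_powBody_le)

/-- Semantics of `powLoopF` (`r ≤ |x|`). [folklore] -/
theorem powLoopF_apply (x : List Bool) (hn : n ≤ x.length) {r : ℕ} (hr : r ≤ x.length) (A P : Matrix (Fin n) (Fin n) ℤ) :
    powLoopF (boolPair x (boolPair (encodeNat r) (boolPair (boolPair (encodeNat n) (matCode A)) (matCode P)))) =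
      matCode ((fun Q => capM n x.length (mulRR n A Q))^[r] P) := by
  rw [powLoopF, Function.comp_apply, loopX_apply _ _ _ hr, loopModel_powBody x hn A r P]
  simp

/-- **The oracle matrix** `P = powCap W N r`: the power loop from `1` on the shifted gradient.
[cite: Jaggi2011, §4, Thm. 18 (chunk p0022)] -/
def powF : List Bool → List Bool := powLoopF ∘ fanoutFn Rx (fanoutFn Rrr (fanoutFn (fanoutFn Rnn gradF) RI))

/-- `powF ∈ FP`. [folklore] -/
theorem powF_mem_FP : powF ∈ FP :=
  comp_mem_FP powLoopF_mem_FP (fanoutFn_mem_FP Rx_mem_FP (fanoutFn_mem_FP Rrr_mem_FP (fanoutFn_mem_FP (fanoutFn_mem_FP Rnn_mem_FP gradF_mem_FP) RI_mem_FP)))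

/-- **Semantics of `powF`** (`n, r ≤ |x|`): `matCode (powCap |x| N r)`. [cite: Jaggi2011, §4, Thm. 18 (chunk p0022)] -/
theorem powF_apply (x : List Bool) (hn : n ≤ x.length) {m : ℕ} (hr : cr n m ≤ x.length) (t : ℕ) (H : SimpleGraph (Fin n)) [DecidableRel H.Adj]
    (N : Matrix (Fin n) (Fin n) ℤ) : powF (stepRec x t m H N) = matCode (powCap n m H x.length N (cr n m)) := by
  have hA := gradF_apply x hn t m H N
  simp only [powF, Function.comp_apply, fanoutFn_apply, Rx_stepRec, Rrr_stepRec, Rnn_stepRec, RI_stepRec, hA]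
  rw [powLoopF_apply x hn hr, powCap_eq_iterate]

/-! ### One saturated Frank–Wolfe step -/

/-- The trace of the oracle matrix: `frobF ⟨x, ⟨nn, ⟨I, P⟩⟩⟩`. [folklore] -/
def trPF : List Bool → List Bool := frobF ∘ fanoutFn Rx (fanoutFn Rnn (fanoutFn RI powF))

/-- `trPF ∈ FP`. [folklore] -/
theorem trPF_mem_FP : trPF ∈ FP :=
  comp_mem_FP frobF_mem_FP (fanoutFn_mem_FP Rx_mem_FP (fanoutFn_mem_FP Rnn_mem_FP (fanoutFn_mem_FP RI_mem_FP powF_mem_FP)))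

/-- Semantics of `trPF`. [folklore] -/
theorem trPF_apply (x : List Bool) (hn : n ≤ x.length) {m : ℕ} (hr : cr n m ≤ x.length) (t : ℕ) (H : SimpleGraph (Fin n)) [DecidableRel H.Adj]
    (N : Matrix (Fin n) (Fin n) ℤ) : trPF (stepRec x t m H N) = dpEnc (powCap n m H x.length N (cr n m)).trace := by
  have hP := powF_apply x hn hr t H N
  simp only [trPF, Function.comp_apply, fanoutFn_apply, Rx_stepRec, Rnn_stepRec, RI_stepRec, hP]
  rw [frobF_apply x hn, sum_one_mul_eq_trace]

/-- The table of pairs `⟨Nᵢⱼ, Pᵢⱼ⟩`. [folklore] -/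
def pairF : List Bool → List Bool := mzipF pairItem ∘ fanoutFn Rx (fanoutFn Rnn (fanoutFn (fun _ => []) (fanoutFn RN powF)))

/-- `pairF ∈ FP`. [folklore] -/
theorem pairF_mem_FP : pairF ∈ FP :=
  comp_mem_FP (mzipF_mem_FP pairItem_mem_FP (w := 2) le_rfl length_pairItem_le)
    (fanoutFn_mem_FP Rx_mem_FP (fanoutFn_mem_FP Rnn_mem_FP (fanoutFn_mem_FP (const_mem_FP _) (fanoutFn_mem_FP RN_mem_FP powF_mem_FP))))

/-- Semantics of `pairF`. [folklore] -/
theorem pairF_apply (x : List Bool) (hn : n ≤ x.length) {m : ℕ} (hr : cr n m ≤ x.length) (t : ℕ) (H : SimpleGraph (Fin n)) [DecidableRel H.Adj]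
    (N : Matrix (Fin n) (Fin n) ℤ) :
    pairF (stepRec x t m H N) = tabCode fun i j => boolPair (dpEnc (N i j)) (dpEnc (powCap n m H x.length N (cr n m) i j)) := by
  have hP := powF_apply x hn hr t H N
  simp only [pairF, Function.comp_apply, fanoutFn_apply, Rx_stepRec, Rnn_stepRec, RN_stepRec, hP, matCode_eq_tabCode]
  rw [mzipF_apply _ x hn]
  refine congrArg tabCode (funext fun i => funext fun j => ?_)
  rw [pairItem_apply]

/-- The scalar record of the step entries: `⟨z2ᵖ, ⟨zt, ⟨zτ, ⟨ztrP, zn⟩⟩⟩⟩`. [folklore] -/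
def stepPrmF : List Bool → List Bool := fanoutFn R2p (fanoutFn Rt (fanoutFn tauF (fanoutFn trPF Rzn)))

/-- `stepPrmF ∈ FP`. [folklore] -/
theorem stepPrmF_mem_FP : stepPrmF ∈ FP :=
  fanoutFn_mem_FP R2p_mem_FP (fanoutFn_mem_FP Rt_mem_FP (fanoutFn_mem_FP tauF_mem_FP (fanoutFn_mem_FP trPF_mem_FP Rzn_mem_FP)))

/-- **One saturated Frank–Wolfe step** `N ↦ stepCap W t N`: the zip of `stepItem` over the mask table and
the table of pairs `⟨Nᵢⱼ, Pᵢⱼ⟩`. [cite: Jaggi2011, Alg. 6 (chunk p0020)] -/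
def stepF : List Bool → List Bool := mzipF stepItem ∘ fanoutFn Rx (fanoutFn Rnn (fanoutFn stepPrmF (fanoutFn RK pairF)))

/-- `stepF ∈ FP`. [folklore] -/
theorem stepF_mem_FP : stepF ∈ FP :=
  comp_mem_FP (mzipF_mem_FP stepItem_mem_FP (w := 0) (by norm_num) length_stepItem_le)
    (fanoutFn_mem_FP Rx_mem_FP (fanoutFn_mem_FP Rnn_mem_FP (fanoutFn_mem_FP stepPrmF_mem_FP (fanoutFn_mem_FP RK_mem_FP pairF_mem_FP))))

/-- **Semantics of `stepF`** (`n, r ≤ |x|`): `stepF ⟨x, ⟨dpEnc t, ⟨prmCode, matCode N⟩⟩⟩ = matCode (stepCap |x| t N)`.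
[cite: Jaggi2011, Alg. 6 (chunk p0020)] -/
theorem stepF_apply (x : List Bool) (hn : n ≤ x.length) {m : ℕ} (hr : cr n m ≤ x.length) (t : ℕ) (H : SimpleGraph (Fin n)) [DecidableRel H.Adj]
    (N : Matrix (Fin n) (Fin n) ℤ) : stepF (stepRec x t m H N) = matCode (stepCap n m H x.length t N) := by
  have hτ := tauF_apply x hn t m H N
  have hP := trPF_apply x hn hr t H N
  have hQ := pairF_apply x hn hr t H N
  simp only [stepF, stepPrmF, Function.comp_apply, fanoutFn_apply, Rx_stepRec, Rnn_stepRec, RK_stepRec, Rt_stepRec, R2p_stepRec,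
    Rzn_stepRec, hτ, hP, hQ, maskCode, matCode_eq_tabCode]
  rw [← stepPrm, mzipF_apply _ x hn]
  refine congrArg tabCode (funext fun i => funext fun j => ?_)
  rw [stepItem_apply, stepCap, capM, stepNum, stepDen, ite_eq_dInd_mul]

/-- The output of a step is absolutely bounded: `≤ stepOut(|x|)`. [folklore] -/
def stepOut : Polynomial ℕ := X * (2 * (X * (2 * (2 * X + 2) + 4)) + 4)

/-- Length of `stepF`: absolute in the yardstick `nthF 0 z`. [folklore] -/
theorem length_stepF_le (z : List Bool) : (stepF z).length ≤ stepOut.eval (nthF 0 z).length := by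
  rw [stepF, Function.comp_apply]
  set w := fanoutFn Rx (fanoutFn Rnn (fanoutFn stepPrmF (fanoutFn RK pairF))) z
  have h := length_mzipF_le (f := stepItem) 0 (P := 2 * X + 2) length_stepItem_le w
  have e0 : fstF w = nthF 0 z := by simp [w, Rx]
  rw [e0] at h
  simpa [stepOut, eval_add, eval_mul, eval_X, eval_ofNat] using h

/-! ### The main loop -/

/-- The step index of a round on `⟨x, ⟨cnt, ⟨prm, N⟩⟩⟩`: `dpEnc (T - ⟦cnt⟧)` (`T` read off the scalar record).
[folklore] -/
def tF : List Bool → List Bool := natToZF ∘ subFn ∘ fanoutFn (fstF ∘ sndPow 2 ∘ nthF 2) (nthF 1)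

/-- `tF ∈ FP`. [folklore] -/
theorem tF_mem_FP : tF ∈ FP :=
  comp_mem_FP natToZF_mem_FP (comp_mem_FP subFn_mem_FP (fanoutFn_mem_FP
    (comp_mem_FP fstF_mem_FP (comp_mem_FP (sndPow_mem_FP 2) (nthF_mem_FP 2))) (nthF_mem_FP 1)))

/-- Semantics of `tF` at a canonical counter. [folklore] -/
theorem tF_apply (x : List Bool) (k m : ℕ) (H : SimpleGraph (Fin n)) [DecidableRel H.Adj] (M : List Bool) :
    tF (boolPair x (boolPair (encodeNat k) (boolPair (prmCode m H) M))) = dpEnc ((cT n m - k : ℕ) : ℤ) := by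
  simp [tF, prmCode, scCode]

/-- **The body of the main loop** on `⟨x, ⟨cnt, ⟨prm, N⟩⟩⟩`: `⟨prm, stepF ⟨x, ⟨dpEnc (T - ⟦cnt⟧), ⟨prm, N⟩⟩⟩⟩`.
[cite: Jaggi2011, Alg. 6 (chunk p0020)] -/
def mainBody : List Bool → List Bool := fanoutFn (nthF 2) (stepF ∘ fanoutFn (nthF 0) (fanoutFn tF (sndPow 1)))

/-- `mainBody ∈ FP`. [folklore] -/
theorem mainBody_mem_FP : mainBody ∈ FP :=
  fanoutFn_mem_FP (nthF_mem_FP 2) (comp_mem_FP stepF_mem_FP (fanoutFn_mem_FP (nthF_mem_FP 0) (fanoutFn_mem_FP tF_mem_FP (sndPow_mem_FP 1))))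

/-- Growth of the main body: `≤ |state| + stepOut(|x|) + 2`. [folklore] -/
theorem length_mainBody_le (z : List Bool) : (mainBody z).length ≤ (sndPow 1 z).length + (stepOut + 2).eval (fstF z).length := by
  have c1 := length_nthF_succ_add_sndPow_succ_le 1 z
  have h := length_stepF_le (boolPair (nthF 0 z) (boolPair (tF z) (sndPow 1 z)))
  simp only [nthF_zero_boolPair, Nat.reduceAdd] at h c1
  simp only [mainBody, fanoutFn_apply, length_boolPair, Function.comp_apply, eval_add, eval_ofNat, nthF_zero]
  have : nthF 0 z = fstF z := rfl
  rw [this] at h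
  omega

/-- **Semantics of `mainBody`** at counter `bin k`: one saturated step with index `t = T - k`. [cite: Jaggi2011, Alg. 6 (chunk p0020)] -/
theorem mainBody_apply (x : List Bool) (hn : n ≤ x.length) {m : ℕ} (hr : cr n m ≤ x.length) (k : ℕ) (H : SimpleGraph (Fin n)) [DecidableRel H.Adj]
    (N : Matrix (Fin n) (Fin n) ℤ) :
    mainBody (boolPair x (boolPair (encodeNat k) (boolPair (prmCode m H) (matCode N)))) =
      boolPair (prmCode m H) (matCode (stepCap n m H x.length (cT n m - k) N)) := by
  have ht := tF_apply x k m H (matCode N)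
  have hs := stepF_apply x hn hr (cT n m - k) H N
  rw [stepRec] at hs
  simp only [mainBody, fanoutFn_apply, nthF_succ_boolPair, nthF_zero_boolPair, Function.comp_apply, sndPow_succ_boolPair, sndPow_zero,
    sndF_boolPair, ht, hs]

/-- **The main loop runs the saturated iteration**: from `iterCap W (T - k)` at counter `k ≤ T`, `k` rounds reach
`iterCap W T`. [cite: Jaggi2011, Alg. 6 (chunk p0020)] -/
theorem loopModel_mainBody (x : List Bool) (hn : n ≤ x.length) {m : ℕ} (hr : cr n m ≤ x.length) (H : SimpleGraph (Fin n)) [DecidableRel H.Adj] :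
    ∀ k, k ≤ cT n m →
      loopModel mainBody x k (boolPair (prmCode m H) (matCode (iterCap n m H x.length (cT n m - k)))) =
        boolPair (prmCode m H) (matCode (iterCap n m H x.length (cT n m)))
  | 0, _ => by simp [loopModel]
  | k + 1, hk => by
    have e : cT n m - (k + 1) + 1 = cT n m - k := by omega
    have e' : stepCap n m H x.length (cT n m - (k + 1)) (iterCap n m H x.length (cT n m - (k + 1))) =
        iterCap n m H x.length (cT n m - k) := by
      rw [← e]; rfl
    rw [loopModel, mainBody_apply x hn hr _ H, e', loopModel_mainBody x hn hr H k (by omega)]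

/-- **The core of the machine**: `coreF ⟨x, ⟨bin T, ⟨prm, N₀⟩⟩⟩` runs the main loop and returns the final matrix.
[cite: Jaggi2011, Alg. 6 (chunk p0020)] -/
def coreF : List Bool → List Bool := sndPow 2 ∘ loopX mainBody

/-- `coreF ∈ FP`. [folklore] -/
theorem coreF_mem_FP : coreF ∈ FP := comp_mem_FP (sndPow_mem_FP 2) (loopX_mem_FP mainBody_mem_FP length_mainBody_le)

/-- **Semantics of `coreF`** (`n, r, T ≤ |x|`): from `N₀ = 1`, the code of `iterCap |x| T`.
[cite: Jaggi2011, Alg. 6 and Thm. 17 (chunk p0022)] -/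
theorem coreF_apply (x : List Bool) (hn : n ≤ x.length) {m : ℕ} (hr : cr n m ≤ x.length) (hT : cT n m ≤ x.length)
    (H : SimpleGraph (Fin n)) [DecidableRel H.Adj] :
    coreF (boolPair x (boolPair (encodeNat (cT n m)) (boolPair (prmCode m H) (matCode (1 : Matrix (Fin n) (Fin n) ℤ))))) =
      matCode (iterCap n m H x.length (cT n m)) := by
  have h0 : matCode (1 : Matrix (Fin n) (Fin n) ℤ) = matCode (iterCap n m H x.length (cT n m - cT n m)) := by
    rw [Nat.sub_self]; rfl
  rw [coreF, Function.comp_apply, loopX_apply _ _ _ hT, h0, loopModel_mainBody x hn hr H _ le_rfl]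
  simp

end ThetaFWMachine

end Literature.Computability.Complexity

end
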